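import Summits.SmoothPoincare4.SmoothPoincare4.Theorems.CylinderEntropyCylinderRungTwoUpperDensityAllScales
import Summits.SmoothPoincare4.SmoothPoincare4.Theorems.CylinderEntropyCylinderRungTwoGoodTimes
import Summits.SmoothPoincare4.SmoothPoincare4.Theorems.CylinderEntropyImmortalAreaToFloorAreaRatio
import Summits.SmoothPoincare4.SmoothPoincare4.Theorems.CylinderEntropyImmortalAreaToFloorOfSmallTilt
import Summits.SmoothPoincare4.SmoothPoincare4.Theorems.CylinderEntropyImmortalAreaToFloorInitialDensity
import HarnessLib

/-!
# Route `CylinderEntropy`, item `ImmortalAreaToFloor` (stmt-SmoothPoincare4-17197):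
# the inputs of the static argument along a thin immortal cylinder flow, in the form consumed by the
# stacking/counting argument (module Γ8 of `BLUEPRINT-17197-c2.md`, part 1)

Along a smooth mean curvature flow `IsCylinderMCF M F ν T` of closed embedded cross-sections of
`N = S⁴ × ℝ ⊂ ℝ⁶` with separating slices of cylinder entropy `< 2`, and with `μ_t` the induced area
measure of `F t`:
* `upperGaussianDensity_late` — a UNIFORM upper bound `∫_M G_τ(F_s - p) dμ_s ≤ 2 - δ₀` for all late
  `s`, all centres `p ∈ N` and all scales `0 < τ ≤ τ_max`, with `δ₀ ∈ (0, 1/2]` (landed: Hamilton's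
  monotonicity in the form `helper_upperDensityAllScales`, the uniform entropy gap
  `exists_cylEntropy_le_ofReal_two_sub`, the density-level Cheeger–Yau domination
  `helper_gaussianAreaLeCylDensity`, and `gaussianArea_range_eq_ofReal_integral`);
* `ahlforsGrowth_of_thin` — quartic area growth `μ_t(F_t⁻¹ B̄(y,r)) ≤ C_A r⁴` at centres `y ∈ N`,
  `0 < r ≤ R₀`, for every thin slice (landed `hausdorff_inter_closedBall_le_of_thinFlow`);
* `exists_late_smallWillmore` — arbitrarily late times with `∫ H² dμ_r ≤ W₁` (landed good times of
  the dissipation, `helper_goodTimes`, and `‖∂_t F‖² = H²`);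
* `riemannianMeasure_univ_eq_smul`, `riemannianMeasure_real_univ_le_initial` —
  `μ_t(M) = κ₄ μH⁴(F_t(M))` (Mathlib's normalising constant `κ₄` of `μHE⁴`) and
  `μ_t(M) ≤ μHE⁴(F_T(M)) < ∞` (areas decrease).

References: R. S. Hamilton, Comm. Anal. Geom. 1 (1993) 127–137; T. H. Colding, W. P. Minicozzi II,
Ann. of Math. 175 (2012); W. K. Allard, Ann. of Math. 95 (1972) §6.
-/

-- the prescribed namespace `Summit.SmoothPoincare4.SmoothPoincare4.…` repeats `SmoothPoincare4`
set_option linter.dupNamespace false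

noncomputable section

open Bundle Set Function Filter MeasureTheory Module
open scoped Manifold ContDiff Topology RealInnerProductSpace BigOperators ENNReal NNReal

namespace Summit.SmoothPoincare4.SmoothPoincare4.Cruxes.CylinderRungTwo.KillingFlux

open Literature.Geometry.Riemannian Literature.Geometry.Riemannian.EuclideanHypersurface
open Literature.Geometry.Lorentzian Literature.Geometry.Lorentzian.PseudoRiemannianMetric
open Literature.Geometry.Riemannian.SphericalCylinderEntropy (cylEntropy cylDensity
  measure_ratio_le_cylEntropy hausdorffMeasure_sphere_four_pos hausdorffMeasure_sphere_four_lt_top)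

variable {M : Type} [TopologicalSpace M] [T2Space M] [SecondCountableTopology M]
  [ChartedSpace (EuclideanSpace ℝ (Fin 4)) M] [IsManifold (𝓡 4) ∞ M] [CompactSpace M]
  [MeasurableSpace M] [BorelSpace M] {F ν : ℝ → M → EuclideanSpace ℝ (Fin 6)} {T : ℝ}

/-- Elementary: `(1 + δ/16)² (2 - δ) + δ/8 ≤ 2 - δ/4` for `0 ≤ δ ≤ 1`. [folklore] -/
theorem upperDensity_arith {δ : ℝ} (hδ : 0 ≤ δ) :
    (1 + δ / 16) * ((1 + δ / 16) * (2 - δ)) + δ / 16 * 2 ≤ 2 - δ / 4 := by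
  nlinarith [sq_nonneg δ, mul_nonneg hδ (sq_nonneg δ)]

omit [T2Space M] [SecondCountableTopology M] [MeasurableSpace M] [BorelSpace M] in
/-- The slice `F_t(M)` is a measurable subset of `N` of bounded height, and its area ratio is at most
its cylinder entropy. [folklore] -/
theorem IsCylinderMCF.ratio_le_cylEntropy (hF : IsCylinderMCF M F ν T) {t : ℝ} (ht : T ≤ t) :
    (μH[4] (Metric.sphere (0 : EuclideanSpace ℝ (Fin 5)) 1))⁻¹ * μH[4] (Set.range (F t)) ≤
      cylEntropy (Set.range (F t)) := by
  have hcpt := hF.isCompact_range ht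
  have hmeas : MeasurableSet (Set.range (F t)) := hcpt.isClosed.measurableSet
  obtain ⟨B, hB⟩ := hcpt.isBounded.exists_norm_le
  have hB' : ∀ z ∈ Set.range (F t), |z 5| ≤ B := fun z hz =>
    le_trans (by simpa [Real.norm_eq_abs] using PiLp.norm_apply_le z 5) (hB z hz)
  have hN : ∀ z ∈ Set.range (F t), ∑ i : Fin 5, z (Fin.castSucc i) ^ 2 = 1 := by
    rintro z ⟨x, rfl⟩; exact hF.mem_cyl t ht x
  exact measure_ratio_le_cylEntropy hmeas hN hB'

/-- **Uniform upper Gaussian density bound at late times (entropy `< 2`).**  Along a cylinder flow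
with separating slices of entropy `< 2` there are `δ₀ ∈ (0, 1/2]`, `τ_max > 0` and `s₀ ≥ T` such that
for all `s ≥ s₀` (`s ≥ T`), `p ∈ N`, `0 < τ ≤ τ_max`:
`∫_M exp(-‖F s w - p‖²/(4τ))/(4πτ)² dμ_s(w) ≤ 2 - δ₀`. [cite: Hamilton1993, §4] -/
theorem upperGaussianDensity_late (hF : IsCylinderMCF M F ν T)
    (hsep : ∀ t, T ≤ t → SeparatesEnds (Set.range (F t)))
    (hthin : ∀ t, T ≤ t → cylEntropy (Set.range (F t)) < 2) :
    ∃ δ₀ : ℝ, 0 < δ₀ ∧ δ₀ ≤ 1 / 2 ∧ ∃ τmax : ℝ, 0 < τmax ∧ ∃ s₀ : ℝ, T ≤ s₀ ∧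
      ∀ s (hsT : T ≤ s), s₀ ≤ s → ∀ p : EuclideanSpace ℝ (Fin 6), ∑ i : Fin 5, p (Fin.castSucc i) ^ 2 = 1 →
        ∀ τ, 0 < τ → τ ≤ τmax →
          ∫ w, Real.exp (-‖F s w - p‖ ^ 2 / (4 * τ)) / (4 * Real.pi * τ) ^ 2
            ∂riemannianMeasure ((euclideanMetric (EuclideanSpace ℝ (Fin 6))).inducedRiemannianMetric (F s)
              contMDiff_pullbackBilin_holds (hF.isSpacelikeImmersion s hsT)) ≤ 2 - δ₀ := by
  -- the entropy gap
  obtain ⟨δ, hδ, hent⟩ := hF.exists_cylEntropy_le_ofReal_two_sub (hthin T le_rfl)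
  set δ₁ : ℝ := min δ 1 with hδ₁
  have hδ₁0 : 0 < δ₁ := lt_min hδ one_pos
  have hδ₁1 : δ₁ ≤ 1 := min_le_right _ _
  have hδ₁δ : δ₁ ≤ δ := min_le_left _ _
  have h16 : 0 < δ₁ / 16 := by positivity
  have h16' : δ₁ / 16 ≤ 1 := by linarith
  -- kernel domination and Hamilton's bound, both with slack `δ₁/16`
  obtain ⟨κ, hκ0, -, t₁, ht₁, hdom⟩ := helper_gaussianAreaLeCylDensity (δ₁ / 16) h16 h16'
  obtain ⟨s₀, hs₀T, hF2⟩ := helper_upperDensityAllScales M F ν T hF hsep (δ₁ / 16) h16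
  refine ⟨δ₁ / 4, by positivity, by linarith, t₁, ht₁, s₀, hs₀T, fun s hsT hs p hp τ hτ hτle => ?_⟩
  set A : Set (EuclideanSpace ℝ (Fin 6)) := Set.range (F s) with hA
  have hcpt : IsCompact A := hF.isCompact_range hsT
  have hAm : MeasurableSet A := hcpt.isClosed.measurableSet
  have hAN : ∀ z ∈ A, ∑ i : Fin 5, z (Fin.castSucc i) ^ 2 = 1 := by
    rintro z ⟨x, rfl⟩; exact hF.mem_cyl s hsT x
  have hvol0 := (hausdorffMeasure_sphere_four_pos).ne'
  have hvoltop := (hausdorffMeasure_sphere_four_lt_top).ne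
  -- the three atoms
  have h1 := hdom A hAN hAm p hp τ hτ hτle
  have h2 := hF2 s hs p hp ((1 + κ) * τ) (by positivity)
  have hinf : (μH[4] (Metric.sphere (0 : EuclideanSpace ℝ (Fin 5)) 1))⁻¹ *
      (⨅ t : Set.Ici T, μH[4] (Set.range (F t))) ≤ ENNReal.ofReal (2 - δ₁) := by
    calc (μH[4] (Metric.sphere (0 : EuclideanSpace ℝ (Fin 5)) 1))⁻¹ * (⨅ t : Set.Ici T, μH[4] (Set.range (F t)))
        ≤ (μH[4] (Metric.sphere (0 : EuclideanSpace ℝ (Fin 5)) 1))⁻¹ * μH[4] (Set.range (F T)) := by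
          gcongr
          exact iInf_le (fun t : Set.Ici T => μH[4] (Set.range (F t))) ⟨T, Set.self_mem_Ici⟩
      _ ≤ cylEntropy (Set.range (F T)) := hF.ratio_le_cylEntropy le_rfl
      _ ≤ ENNReal.ofReal (2 - δ) := hent T le_rfl
      _ ≤ ENNReal.ofReal (2 - δ₁) := ENNReal.ofReal_le_ofReal (by linarith)
  have hratio : (μH[4] (Metric.sphere (0 : EuclideanSpace ℝ (Fin 5)) 1))⁻¹ * μH[4] A ≤ 2 := by
    calc (μH[4] (Metric.sphere (0 : EuclideanSpace ℝ (Fin 5)) 1))⁻¹ * μH[4] A ≤ cylEntropy A :=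
          hF.ratio_le_cylEntropy hsT
      _ ≤ 2 := (hthin s hsT).le
  -- assemble in `ℝ≥0∞`
  have hG : gaussianArea 4 p τ A ≤ ENNReal.ofReal ((1 + δ₁ / 16) * ((1 + δ₁ / 16) * (2 - δ₁)) + δ₁ / 16 * 2) := by
    have hx : 0 ≤ 2 - δ₁ := by linarith
    calc gaussianArea 4 p τ A
        ≤ ENNReal.ofReal (1 + δ₁ / 16) * cylDensity A p ((1 + κ) * τ) +
            ENNReal.ofReal (δ₁ / 16) * ((μH[4] (Metric.sphere (0 : EuclideanSpace ℝ (Fin 5)) 1))⁻¹ * μH[4] A) := h1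
      _ ≤ ENNReal.ofReal (1 + δ₁ / 16) * (ENNReal.ofReal (1 + δ₁ / 16) * ENNReal.ofReal (2 - δ₁)) +
            ENNReal.ofReal (δ₁ / 16) * 2 := by
          gcongr
          exact h2.trans (mul_le_mul' le_rfl hinf)
      _ = ENNReal.ofReal ((1 + δ₁ / 16) * ((1 + δ₁ / 16) * (2 - δ₁)) + δ₁ / 16 * 2) := by
          rw [← ENNReal.ofReal_mul (by positivity), ← ENNReal.ofReal_mul (by positivity),
            ← ENNReal.ofReal_ofNat 2, ← ENNReal.ofReal_mul (by positivity),
            ← ENNReal.ofReal_add (by positivity) (by positivity)]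
  have harith := upperDensity_arith hδ₁0.le
  have hG' : gaussianArea 4 p τ A ≤ ENNReal.ofReal (2 - δ₁ / 4) :=
    hG.trans (ENNReal.ofReal_le_ofReal harith)
  rw [hA, gaussianArea_range_eq_ofReal_integral (hF.isSpacelikeImmersion s hsT) (hF.injective hsT) p hτ]
    at hG'
  exact (ENNReal.ofReal_le_ofReal_iff (by linarith)).1 hG'

/-- **Quartic (Ahlfors) area growth of thin slices, for the induced area measure.**  There are
`C_A ≥ 0` and `R₀ > 0` (universal) such that along every cylinder flow, every slice with
`λ_cyl < 2` (`t ≥ T`) satisfies `μ_t(F_t⁻¹ B̄(y,r)) ≤ C_A r⁴` for `y ∈ N`, `0 < r ≤ R₀`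
(`μ_t(F_t⁻¹ B̄) = μHE⁴(F_t(M) ∩ B̄) = κ₄ μH⁴(F_t(M) ∩ B̄)`). [cite: ColdingMinicozzi2012, Lemma 2.9] -/
theorem ahlforsGrowth_of_thin :
    ∃ CA : ℝ, 0 ≤ CA ∧ ∃ R₀ : ℝ, 0 < R₀ ∧
      ∀ (M : Type) [TopologicalSpace M] [T2Space M] [ChartedSpace (EuclideanSpace ℝ (Fin 4)) M]
        [IsManifold (𝓡 4) ∞ M] [CompactSpace M] [MeasurableSpace M] [BorelSpace M]
        (F ν : ℝ → M → EuclideanSpace ℝ (Fin 6)) (T : ℝ) (hF : IsCylinderMCF M F ν T)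
        (t : ℝ) (ht : T ≤ t), cylEntropy (Set.range (F t)) < 2 →
        ∀ y : EuclideanSpace ℝ (Fin 6), ∑ i : Fin 5, y (Fin.castSucc i) ^ 2 = 1 →
        ∀ r, 0 < r → r ≤ R₀ →
          (riemannianMeasure ((euclideanMetric (EuclideanSpace ℝ (Fin 6))).inducedRiemannianMetric (F t)
            contMDiff_pullbackBilin_holds (hF.isSpacelikeImmersion t ht))).real
              (F t ⁻¹' Metric.closedBall y r) ≤ CA * r ^ 4 := by
  obtain ⟨C, hC, r₀, hr₀, h⟩ := Summit.SmoothPoincare4.SmoothPoincare4.Theorems.hausdorff_inter_closedBall_le_of_thinFlow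
  set κ₄ : ℝ≥0 := Measure.addHaarScalarFactor (volume : Measure (EuclideanSpace ℝ (Fin 4)))
    (μH[(4 : ℕ)] : Measure (EuclideanSpace ℝ (Fin 4))) with hκ₄
  have hκC : (κ₄ : ℝ≥0∞) * C ≠ ⊤ := ENNReal.mul_ne_top ENNReal.coe_ne_top hC.ne
  refine ⟨((κ₄ : ℝ≥0∞) * C).toReal, ENNReal.toReal_nonneg, r₀, hr₀, ?_⟩
  intro M _ _ _ _ _ _ _ F ν T hF t ht hthin y hy r hr hrle
  have hE := h M F ν T hF t ht hthin y hy r hr hrle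
  have hfc : Continuous (F t) := (hF.isSmoothEmbedding t ht).contMDiff.continuous
  have hSm : MeasurableSet (F t ⁻¹' Metric.closedBall y r) :=
    (Metric.isClosed_closedBall.preimage hfc).measurableSet
  have hμ : riemannianMeasure ((euclideanMetric (EuclideanSpace ℝ (Fin 6))).inducedRiemannianMetric (F t)
      contMDiff_pullbackBilin_holds (hF.isSpacelikeImmersion t ht)) (F t ⁻¹' Metric.closedBall y r) =
      (κ₄ : ℝ≥0∞) * μH[4] (Set.range (F t) ∩ Metric.closedBall y r) := by
    rw [riemannianMeasure_induced_apply (hF.isSpacelikeImmersion t ht) (hF.injective ht) hSm,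
      Set.image_preimage_eq_inter_range, Set.inter_comm, Measure.euclideanHausdorffMeasure_def,
      Measure.smul_apply, ENNReal.smul_def, smul_eq_mul]
    rfl
  rw [measureReal_def, hμ]
  have hle : (κ₄ : ℝ≥0∞) * μH[4] (Set.range (F t) ∩ Metric.closedBall y r) ≤
      (κ₄ : ℝ≥0∞) * C * ENNReal.ofReal (r ^ 4) := by
    rw [mul_assoc]; exact mul_le_mul' le_rfl hE
  calc ((κ₄ : ℝ≥0∞) * μH[4] (Set.range (F t) ∩ Metric.closedBall y r)).toReal
      ≤ ((κ₄ : ℝ≥0∞) * C * ENNReal.ofReal (r ^ 4)).toReal :=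
        ENNReal.toReal_mono (ENNReal.mul_ne_top hκC ENNReal.ofReal_ne_top) hle
    _ = ((κ₄ : ℝ≥0∞) * C).toReal * r ^ 4 := by
        rw [ENNReal.toReal_mul, ENNReal.toReal_ofReal (by positivity)]

/-- **Arbitrarily late times of small Willmore energy** (`∫ H² dμ_r ≤ W₁`): good times of the
dissipation budget (`helper_goodTimes`) read through `‖∂_t F‖² = H²` and `κ₄ ∫⁻ d(F_r^*μH⁴) = ∫⁻ dμ_r`.
[cite: Huisken1984, §3] -/
theorem exists_late_smallWillmore (hF : IsCylinderMCF M F ν T) {W₁ : ℝ} (hW₁ : 0 < W₁) {s₁ : ℝ}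
    (hs₁ : T ≤ s₁) :
    ∃ r : ℝ, ∃ hr : T ≤ r, s₁ ≤ r ∧
      ∫ w, (euclideanMetric (EuclideanSpace ℝ (Fin 6))).meanCurvature (F r) contMDiff_pullbackBilin_holds
          (hF.isSpacelikeImmersion r hr) (ν r) w ^ 2
        ∂riemannianMeasure ((euclideanMetric (EuclideanSpace ℝ (Fin 6))).inducedRiemannianMetric (F r)
          contMDiff_pullbackBilin_holds (hF.isSpacelikeImmersion r hr)) ≤ W₁ := by
  set κ₄ : ℝ≥0 := Measure.addHaarScalarFactor (volume : Measure (EuclideanSpace ℝ (Fin 4)))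
    (μH[(4 : ℕ)] : Measure (EuclideanSpace ℝ (Fin 4))) with hκ₄
  have hκ0 : κ₄ ≠ 0 := Measure.addHaarScalarFactor_volume_hausdorffMeasure_ne_zero 4
  have hcE : (μHE[4] : Measure (EuclideanSpace ℝ (Fin 6))) = κ₄ • (μH[4] : Measure (EuclideanSpace ℝ (Fin 6))) :=
    Measure.euclideanHausdorffMeasure_def 4
  obtain ⟨htend, hgood⟩ := helper_goodTimes M F ν T hF
  -- the target in the units of `F_r^* μH⁴`
  set η : ℝ≥0∞ := ENNReal.ofReal W₁ / κ₄ with hη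
  have hη0 : 0 < η := ENNReal.div_pos (ENNReal.ofReal_pos.2 hW₁).ne' ENNReal.coe_ne_top
  obtain ⟨s₂, hs₂⟩ : ∃ s₂ : ℝ, ∀ s, s₂ ≤ s →
      (∫⁻ r in Set.Icc s (s + 1), ∫⁻ x, ENNReal.ofReal (‖deriv (fun s' => F s' x) r‖ ^ 2)
        ∂(Measure.comap (F r) (μH[4] : Measure (EuclideanSpace ℝ (Fin 6))))) < η := by
    have := (tendsto_order.1 htend).2 η hη0
    rw [Filter.eventually_atTop] at this
    exact this
  set s : ℝ := max s₁ s₂ with hs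
  have hsT : T ≤ s := hs₁.trans (le_max_left _ _)
  obtain ⟨r, hr, hle⟩ := hgood s hsT
  have hrT : T ≤ r := hsT.trans hr.1
  refine ⟨r, hrT, (le_max_left _ _).trans hr.1, ?_⟩
  have hEr : ∫⁻ x, ENNReal.ofReal (‖deriv (fun s' => F s' x) r‖ ^ 2)
      ∂(Measure.comap (F r) (μH[4] : Measure (EuclideanSpace ℝ (Fin 6)))) ≤ η :=
    hle.trans (hs₂ s (le_max_right _ _)).le
  -- convert to the induced area measure and to `H²`
  set g₁ := (euclideanMetric (EuclideanSpace ℝ (Fin 6))).inducedRiemannianMetric (F r)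
    contMDiff_pullbackBilin_holds (hF.isSpacelikeImmersion r hrT) with hg₁
  have hconv := hF.mul_lintegral_comap_eq hrT hcE (fun x => ENNReal.ofReal (‖deriv (fun s' => F s' x) r‖ ^ 2))
  have hcont : Continuous fun w => ‖deriv (fun s' => F s' w) r‖ ^ 2 :=
    (hF.continuous_deriv_slice hrT).norm.pow 2
  have hint : Integrable (fun w => ‖deriv (fun s' => F s' w) r‖ ^ 2) (riemannianMeasure g₁) :=
    integrable_of_continuous (h := g₁) hcont
  have hof : ∫⁻ w, ENNReal.ofReal (‖deriv (fun s' => F s' w) r‖ ^ 2) ∂riemannianMeasure g₁ =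
      ENNReal.ofReal (∫ w, ‖deriv (fun s' => F s' w) r‖ ^ 2 ∂riemannianMeasure g₁) :=
    (ofReal_integral_eq_lintegral_ofReal hint (Eventually.of_forall fun w => by positivity)).symm
  have hH : ∫ w, (euclideanMetric (EuclideanSpace ℝ (Fin 6))).meanCurvature (F r) contMDiff_pullbackBilin_holds
      (hF.isSpacelikeImmersion r hrT) (ν r) w ^ 2 ∂riemannianMeasure g₁ =
      ∫ w, ‖deriv (fun s' => F s' w) r‖ ^ 2 ∂riemannianMeasure g₁ :=
    integral_congr_ae (Eventually.of_forall fun w => (hF.norm_deriv_sq hrT w).symm)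
  rw [hH]
  have hbound : ENNReal.ofReal (∫ w, ‖deriv (fun s' => F s' w) r‖ ^ 2 ∂riemannianMeasure g₁) ≤ ENNReal.ofReal W₁ := by
    rw [← hof, ← hconv]
    calc (κ₄ : ℝ≥0∞) * ∫⁻ x, ENNReal.ofReal (‖deriv (fun s' => F s' x) r‖ ^ 2)
          ∂(Measure.comap (F r) (μH[4] : Measure (EuclideanSpace ℝ (Fin 6))))
        ≤ (κ₄ : ℝ≥0∞) * η := mul_le_mul' le_rfl hEr
      _ = ENNReal.ofReal W₁ := by
          rw [hη, ENNReal.mul_div_cancel (ENNReal.coe_ne_zero.2 hκ0) ENNReal.coe_ne_top]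
  exact (ENNReal.ofReal_le_ofReal_iff hW₁.le).1 hbound

omit [SecondCountableTopology M] in
/-- **`μ_t(M) = κ₄ · μH⁴(F_t(M))`** with Mathlib's normalising constant `κ₄` of `μHE⁴`
(area formula for embeddings). [cite: Federer1969, 3.2.3] -/
theorem IsCylinderMCF.riemannianMeasure_univ_eq_smul (hF : IsCylinderMCF M F ν T) {t : ℝ} (ht : T ≤ t) :
    riemannianMeasure ((euclideanMetric (EuclideanSpace ℝ (Fin 6))).inducedRiemannianMetric (F t)
        contMDiff_pullbackBilin_holds (hF.isSpacelikeImmersion t ht)) Set.univ =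
      (Measure.addHaarScalarFactor (volume : Measure (EuclideanSpace ℝ (Fin 4)))
        (μH[(4 : ℕ)] : Measure (EuclideanSpace ℝ (Fin 4))) : ℝ≥0∞) * μH[4] (Set.range (F t)) := by
  rw [← hF.euclideanHausdorffMeasure_range_eq ht, Measure.euclideanHausdorffMeasure_def, Measure.smul_apply,
    ENNReal.smul_def, smul_eq_mul]
  simp only [Nat.cast_ofNat]

omit [SecondCountableTopology M] in
/-- **Areas decrease: `μ_t(M) ≤ μHE⁴(F_T(M)) < ∞`** for `t ≥ T`. [cite: Huisken1984, §3] -/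
theorem IsCylinderMCF.riemannianMeasure_real_univ_le_initial (hF : IsCylinderMCF M F ν T) {t : ℝ}
    (ht : T ≤ t) :
    (riemannianMeasure ((euclideanMetric (EuclideanSpace ℝ (Fin 6))).inducedRiemannianMetric (F t)
        contMDiff_pullbackBilin_holds (hF.isSpacelikeImmersion t ht))).real Set.univ ≤
      ((μHE[4] : Measure (EuclideanSpace ℝ (Fin 6))) (Set.range (F T))).toReal := by
  rw [measureReal_def, ← hF.euclideanHausdorffMeasure_range_eq ht]
  have hanti := hF.antitoneOn_euclideanHausdorffMeasure_range Set.self_mem_Ici (Set.mem_Ici.2 ht) ht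
  have htop : (μHE[4] : Measure (EuclideanSpace ℝ (Fin 6))) (Set.range (F T)) ≠ ⊤ := by
    rw [hF.euclideanHausdorffMeasure_range_eq le_rfl]
    haveI := isFiniteMeasure_riemannianMeasure ((euclideanMetric (EuclideanSpace ℝ (Fin 6))).inducedRiemannianMetric
      (F T) contMDiff_pullbackBilin_holds (hF.isSpacelikeImmersion T le_rfl))
    exact measure_ne_top _ _
  exact ENNReal.toReal_mono htop hanti

end Summit.SmoothPoincare4.SmoothPoincare4.Cruxes.CylinderRungTwo.KillingFlux

end
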